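import Literature.AnabelianGeometry.EtaleTheta.LogDivisorModelTateTowerKummerTwistLevel
import Literature.AnabelianGeometry.EtaleTheta.LogDivisorModelTateTowerKummer

/-!
# [EtTh] Def. 3.3: the finite-level twist group `(μ ⋊ Aut μ) × ℤ_γ` acting on a Kummer level of the ζ-TWISTED Tate
# tower — the constant-field factor moves the roots of unity through its CHARACTER

S. Mochizuki, *The étale theta function …*, Publ. RIMS **45** (2009) [MochizukiEtTh2009], §3 Def. 3.1 / Prop. 3.2 (PDF
p.70), Def. 3.3 (ii)–(iii) / Rmk. 3.3.1 (p.73); §1 p.13 («`K_N := K(ζ_N, q_X^{1/N})`»: the constant field acts on the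
`N`-th roots through the cyclotomic character) [cite: MochizukiEtTh2009, Def 3.3 p.73].

CLASS (b) MODEL / NON-VACUITY WITNESS (abc-iut cell, layer L2; L2-lead rows R677 / R689 / R722; seat abc-iut-L2-d2 gen 6),
piece (a) file 2 of 2, over file 1 `LogDivisorModelTateTowerKummerTwistLevel.lean` (`TateTowerTwist.model A`: functions
`μ × ⟨ϖ_m⟩ × ⟨U_m⟩` over the Tate skeleton); consumed BY NAME: abc-iut-w6-d058's `GaloisAction` / `GaloisAction.comap` and
the skeleton's `shiftDIV`, `shearFn`, `actDIVHom`, `permCompHom` (p444705); nothing landed is edited or restated.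

* §2 the **finite-level twist group** `Twist A := (A ⋊ MulAut A) × Multiplicative ℤ` and its action `actFnHom` on
  functions: `((a, u), g) · (ζ, ϖ^c U^k) := (u(ζ)·a^k, ϖ^{c−kg} U^k)` — `u ∈ Aut μ` = the CYCLOTOMIC CHARACTER on the
  constants, `a ∈ μ` = the Kummer coordinate twisting the `U`-root (`U_m ↦ a·U_m`), `g ∈ ℤ_γ` = translation of the
  chain; on log-divisors / components only `ℤ_γ` acts; **`action A : (model A).GaloisAction (Twist A)`**, ALL laws
  proved (divisor equivariant, multiplicities permuted, `L^×`/`O_L^▷` stable); `actionOf ρ` = its restriction along ANY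
  `ρ : P →* Twist A` — abc-iut-L1-t6's `TateTowerKummerTwist.Grp = (K ⋊_χ C) × ℤ_γ` (p471292) plugs in LEVEL-WISE
  through its level-`n` coordinates reduced to the modulus of the level (`K → μ_m` on the `U`-class, `χ_m : C → Aut μ_m`
  via `zmodChar`, the translation); piece (d) pulls these back along `TateTowerKummerTwist.Compat` (p472997), on which —
  and only on which — the transition maps are equivariant (abc-iut-L1-t6's finding (b′)).
* §3 CONTENT: `actFnHom_zeta` (roots of unity move by the character), `actFnHom_coordU` (`U_m ↦ a·ϖ_m^{−g}·U_m`),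
  `actFnHom_unif` (`ϖ_m` fixed), **`forall_const_eq_self_iff`: an element fixes the constant field `L^× = μ × ⟨ϖ_m⟩` iff
  its character component is trivial** — the constant-field factor acts through a NON-TRIVIAL character as soon as
  `u ≠ 1` (`exists_const_ne_of_ne_one`); `coordUFamily_not_mem_fZero` (`B₀ ≠ F₀` at the regular `Twist A`-set);
  `nonempty_divisorMonoids`.
* §4 the lead's «ZMod shape» (R689 (3)): `zmodChar m : (ℤ/m)ˣ →* MulAut (Multiplicative (ZMod m))`, `ζ^e ↦ ζ^{ue}` —
  χ GENUINELY CYCLOTOMIC, injective — and `exists_const_ne_of_two_lt`: for `m ≥ 3` the unit `−1` MOVES a constant.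

WHY ONLY THE `U`-ROOT IS KUMMER-TWISTED (design note for piece (d)): a twist of the `ϖ`-root `(ζ, ϖ^c U^k) ↦ (ζ·b^c, …)`
does NOT commute with the chain translation `ϖ^c U^k ↦ ϖ^{c−kg} U^k` (they differ by `b^{−kg}`), so inside a DIRECT
product `(K ⋊ C) × ℤ_γ` the second Kummer coordinate of p471292 must act trivially on the level; the genuine relation is
of Heisenberg type and is outside this design model (HONEST LABEL).
HANDOFF SPEC for piece (d) (the TOWER over `TateTowerKummerTwist.Compat` / `levelsC`): level `n ↦ model (μ_{(n+1)!})`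
(`Δ_n ∩ compat` = Kummer class `≡ 0 mod (n+1)!`, so level `n` carries `(n+1)!`-th roots; level `0` = the skeleton with
`μ` trivial), `act n = actionOf (ρ_n ∘ compat.subtype)` with `ρ_n` = (the `U`-class and `χ` at coordinate `n` reduced mod
`(n+1)!` via `ZMod.castHom`, the translation), `resFn = (ι, (·)^e)` with `ι : μ_{(i+1)!} ↪ μ_{(j+1)!}` multiplication by
`e = (j+1)!/(i+1)!`; equivariance = the compatibilities `k_j ≡ k_i`, `c_j ≡ c_i (mod M_i)` defining `compat`; then
`act_closure_*`, `RootLaw`, `isTempered` as in `LogDivisorModelTateTowerKummer(RootLaw/Tempered).lean`.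
HONEST LABEL: a class-(b) combinatorial DESIGN model, NOT the formal-scheme tower of a Tate curve; the Galois group of the
constant field is modelled as acting on `μ` ONLY (`ϖ_m` fixed); nothing here bears on [IUTchIII] Cor. 3.12; no side
taken; typed ≠ proved.
-/

noncomputable section

namespace Literature.AnabelianGeometry.EtaleTheta

open CategoryTheory

namespace LogDivisorModel

namespace TateTowerTwist

open TateTower

variable (A : Type) [CommGroup A] [Finite A]

/-! ## §2 The finite-level twist group `(μ ⋊ Aut μ) × ℤ_γ` and its Galois action -/

omit [Finite A] in
/-- **The finite-level twist group**: `(μ ⋊ Aut μ) × ℤ_γ` — Kummer coordinate `a ∈ μ`, constant-field automorphism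
`u ∈ Aut μ` (the cyclotomic character; `Aut μ` acting on `μ` tautologically in the semidirect product), chain
translation `g ∈ ℤ_γ`. [cite: MochizukiEtTh2009, Def 3.3 (ii) p.73] -/
abbrev Twist : Type := (A ⋊[MonoidHom.id (MulAut A)] MulAut A) × Multiplicative ℤ

variable {A}

omit [Finite A] in
/-- The Kummer twist by the root of unity `a ∈ μ`: `U_m ↦ a·U_m`, i.e. `(ζ, ϖ^c U^k) ↦ (ζ·a^k, ϖ^c U^k)`.
[cite: MochizukiEtTh2009, Def 3.3 (ii) p.73] -/
def kummerFn (a : A) : MulAut (Fn A) where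
  toFun f := (f.1 * a ^ (Multiplicative.toAdd f.2).2, f.2)
  invFun f := (f.1 * a⁻¹ ^ (Multiplicative.toAdd f.2).2, f.2)
  left_inv f := Prod.ext (by
    change f.1 * a ^ (Multiplicative.toAdd f.2).2 * a⁻¹ ^ (Multiplicative.toAdd f.2).2 = f.1
    rw [inv_zpow, mul_inv_cancel_right]) rfl
  right_inv f := Prod.ext (by
    change f.1 * a⁻¹ ^ (Multiplicative.toAdd f.2).2 * a ^ (Multiplicative.toAdd f.2).2 = f.1
    rw [inv_zpow, inv_mul_cancel_right]) rfl
  map_mul' f g := Prod.ext (by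
    change (f.1 * g.1) * a ^ (Multiplicative.toAdd (f.2 * g.2)).2 =
      f.1 * a ^ (Multiplicative.toAdd f.2).2 * (g.1 * a ^ (Multiplicative.toAdd g.2).2)
    rw [toAdd_mul, Prod.snd_add, zpow_add, mul_mul_mul_comm]) rfl

omit [Finite A] in
/-- `kummerFn a` evaluated. [cite: MochizukiEtTh2009, Def 3.3 (ii) p.73] -/
@[simp] theorem kummerFn_apply (a : A) (f : Fn A) :
    kummerFn a f = (f.1 * a ^ (Multiplicative.toAdd f.2).2, f.2) := rfl

omit [Finite A] in
/-- The constant-field automorphism `u ∈ Aut μ`: `(ζ, ϖ^c U^k) ↦ (u ζ, ϖ^c U^k)`. [cite: MochizukiEtTh2009, Def 3.3 (ii) p.73] -/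
def charFn (u : MulAut A) : MulAut (Fn A) := MulEquiv.prodCongr u (MulEquiv.refl _)

omit [Finite A] in
/-- `charFn u` evaluated. [cite: MochizukiEtTh2009, Def 3.3 (ii) p.73] -/
@[simp] theorem charFn_apply (u : MulAut A) (f : Fn A) : charFn u f = (u f.1, f.2) := rfl

omit [Finite A] in
/-- The chain translation `g ∈ ℤ_γ` on functions: the skeleton's shear `ϖ^c U^k ↦ ϖ^{c − k g} U^k`, identity on `μ`.
[cite: MochizukiEtTh2009, Def 3.3 (ii) p.73] -/
def transFn (t : ℤ) : MulAut (Fn A) := MulEquiv.prodCongr (MulEquiv.refl A) (shearFn t)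

omit [Finite A] in
/-- `transFn t` evaluated. [cite: MochizukiEtTh2009, Def 3.3 (ii) p.73] -/
@[simp] theorem transFn_apply (t : ℤ) (f : Fn A) : transFn t f = (f.1, shearFn t f.2) := rfl

omit [Finite A] in
/-- The automorphism of the functions attached to a twist-group element `((a, u), g)`: translate, apply the character,
Kummer-twist — `(ζ, ϖ^c U^k) ↦ (u(ζ)·a^k, ϖ^{c−kg} U^k)`. [cite: MochizukiEtTh2009, Def 3.3 (ii) p.73] -/
def actFnAut (x : Twist A) : MulAut (Fn A) :=
  (transFn (Multiplicative.toAdd x.2)).trans ((charFn x.1.right).trans (kummerFn x.1.left))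

omit [Finite A] in
/-- `actFnAut x` evaluated: `((a, u), g) · (ζ, v) = (u ζ · a^k, shear_g v)` (`k` the `U`-exponent of `v`).
[cite: MochizukiEtTh2009, Def 3.3 (ii) p.73] -/
@[simp] theorem actFnAut_apply (x : Twist A) (f : Fn A) :
    actFnAut x f = (x.1.right f.1 * x.1.left ^ (Multiplicative.toAdd f.2).2,
      shearFn (Multiplicative.toAdd x.2) f.2) := rfl

omit [Finite A] in
/-- Shears compose additively. [cite: MochizukiEtTh2009, Def 3.3 (ii) p.73] -/
theorem shearFn_add (s t : ℤ) (v : Multiplicative (ℤ × ℤ)) : shearFn (s + t) v = shearFn s (shearFn t v) :=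
  Multiplicative.toAdd.injective (Prod.ext (by simp only [toAdd_shearFn]; ring) (by simp only [toAdd_shearFn]))

omit [Finite A] in
/-- The trivial shear is the identity. [cite: MochizukiEtTh2009, Def 3.3 (ii) p.73] -/
theorem shearFn_zero (v : Multiplicative (ℤ × ℤ)) : shearFn 0 v = v :=
  Multiplicative.toAdd.injective (Prod.ext (by simp only [toAdd_shearFn, mul_zero, sub_zero]) (by simp only [toAdd_shearFn]))

omit [Finite A] in
/-- **The twist group acting on the functions of the level** (a homomorphism `(μ ⋊ Aut μ) × ℤ_γ → Aut(μ × ℤ²)`): the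
semidirect-product law `u · a · u⁻¹ = u(a)` is exactly what makes `x ↦ actFnAut x` multiplicative.
[cite: MochizukiEtTh2009, Def 3.3 (ii) p.73] -/
def actFnHom : Twist A →* MulAut (Fn A) where
  toFun := actFnAut
  map_one' := MulEquiv.ext fun f => Prod.ext
    (by rw [actFnAut_apply, MulAut.one_apply]
        change (1 : MulAut A) f.1 * (1 : A) ^ _ = f.1
        rw [MulAut.one_apply, one_zpow, mul_one])
    (by rw [actFnAut_apply, MulAut.one_apply]
        change shearFn (Multiplicative.toAdd (1 : Multiplicative ℤ)) f.2 = f.2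
        rw [toAdd_one, shearFn_zero])
  map_mul' x y := MulEquiv.ext fun f => Prod.ext
    (by rw [MulAut.mul_apply, actFnAut_apply, actFnAut_apply, actFnAut_apply]
        change (x.1.right * y.1.right) f.1 * (x.1.left * x.1.right y.1.left) ^ (Multiplicative.toAdd f.2).2 =
          x.1.right (y.1.right f.1 * y.1.left ^ (Multiplicative.toAdd f.2).2) *
            x.1.left ^ (Multiplicative.toAdd (shearFn (Multiplicative.toAdd y.2) f.2)).2
        rw [MulAut.mul_apply, map_mul, map_zpow, mul_zpow, toAdd_shearFn]
        simp only [mul_comm, mul_left_comm])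
    (by rw [MulAut.mul_apply, actFnAut_apply, actFnAut_apply, actFnAut_apply]
        change shearFn (Multiplicative.toAdd (x.2 * y.2)) f.2 = shearFn _ (shearFn _ f.2)
        rw [toAdd_mul, shearFn_add])

omit [Finite A] in
/-- `actFnHom x = actFnAut x`. [cite: MochizukiEtTh2009, Def 3.3 (ii) p.73] -/
@[simp] theorem actFnHom_apply (x : Twist A) (f : Fn A) :
    actFnHom x f = (x.1.right f.1 * x.1.left ^ (Multiplicative.toAdd f.2).2,
      shearFn (Multiplicative.toAdd x.2) f.2) := rfl

omit [Finite A] in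
/-- The twist group acting on log-divisors: only the translation `ℤ_γ` acts (the skeleton's `TateTower.actDIVHom`).
[cite: MochizukiEtTh2009, Def 3.3 (ii) p.73] -/
def actDIVHom : Twist A →* MulAut (Multiplicative (TateTower.Idx → ℤ)) :=
  TateTower.actDIVHom.comp (MonoidHom.snd _ _)

omit [Finite A] in
/-- The twist group permuting the components: translation by `g` (the skeleton's `TateTower.permCompHom`).
[cite: MochizukiEtTh2009, Def 3.3 (ii) p.73] -/
def permCompHom : Twist A →* Equiv.Perm ℤ := TateTower.permCompHom.comp (MonoidHom.snd _ _)

variable (A)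

/-- **The Galois action of the finite-level twist group on the level** (every law proved): functions by `actFnHom`,
log-divisors and components by translation, no cusps.  The divisor is equivariant because the root-of-unity factor and
the Kummer twist do not change divisors while the translation shifts them exactly as in the skeleton.
[cite: MochizukiEtTh2009, Def 3.3 p.73] -/
def action : (model A).GaloisAction (Twist A) where
  actFn := actFnHom
  actDIV := actDIVHom
  permCusp := 1
  permComp := permCompHom
  act_mem_DIVplus g d hd x := by
    change 0 ≤ Multiplicative.toAdd (shiftDIV (Multiplicative.toAdd g.2) d) x
    rw [toAdd_shiftDIV]
    exact hd _
  act_mem_Div _ _ _ := trivial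
  act_mem_logMero _ _ _ := trivial
  act_mem_const g f hf := by
    have hk := (mem_const_iff A f).1 hf
    refine (mem_const_iff A _).2 ?_
    change (Multiplicative.toAdd (shearFn (Multiplicative.toAdd g.2) f.2)).2 = 0
    rw [toAdd_shearFn]
    exact hk
  act_mem_intConst g f hf := by
    obtain ⟨hc, hk⟩ := hf
    refine ⟨?_, ?_⟩
    · change 0 ≤ (Multiplicative.toAdd (shearFn (Multiplicative.toAdd g.2) f.2)).1
      rw [toAdd_shearFn, hk, zero_mul, sub_zero]
      exact hc
    · change (Multiplicative.toAdd (shearFn (Multiplicative.toAdd g.2) f.2)).2 = 0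
      rw [toAdd_shearFn]
      exact hk
  divisor_act g f := by
    refine Multiplicative.toAdd.injective (funext fun x => ?_)
    change divFun (Multiplicative.toAdd (shearFn (Multiplicative.toAdd g.2) f.1.2)) x =
      Multiplicative.toAdd (shiftDIV (Multiplicative.toAdd g.2) (divHom f.1.2)) x
    rw [toAdd_shearFn, toAdd_shiftDIV, toAdd_divHom, pos_shiftIdx_symm]
    simp only [divFun]
    ring
  mult_act g d x := by
    rcases x with c | n
    · exact PEmpty.elim c
    · change (Multiplicative.toAdd (shiftDIV (Multiplicative.toAdd g.2) d.1)
          (Sum.inr (Equiv.addRight (Multiplicative.toAdd g.2) n))).toNat = (Multiplicative.toAdd d.1 (Sum.inr n)).toNat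
      rw [toAdd_shiftDIV, Equiv.coe_addRight, shiftIdx_symm_inr, add_sub_cancel_right]
      rfl

/-- `actFn` of the action is `actFnHom`. [cite: MochizukiEtTh2009, Def 3.3 p.73] -/
@[simp] theorem action_actFn : (action A).actFn = actFnHom := rfl

/-- `actDIV` of the action is the translation of the skeleton. [cite: MochizukiEtTh2009, Def 3.3 p.73] -/
@[simp] theorem action_actDIV (g : Twist A) : (action A).actDIV g = shiftDIV (Multiplicative.toAdd g.2) := rfl

/-- **Restriction along any homomorphism** `ρ : P → (μ ⋊ Aut μ) × ℤ_γ`: the Galois action of an arbitrary group `P` on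
the level (abc-iut-w6-d058's `GaloisAction.comap`).  A profinite group of the shape `(K ⋊_χ C) × ℤ_γ` acts on the
level `μ = μ_m` through `K → μ_m` (Kummer coordinate mod `m`), `χ_m : C → Aut μ_m` (cyclotomic character mod `m`) and
the translation. [cite: MochizukiEtTh2009, Def 3.3 p.73] -/
def actionOf {P : Type} [Group P] (ρ : P →* Twist A) : (model A).GaloisAction P := (action A).comap ρ

/-- `actionOf ρ` on functions. [cite: MochizukiEtTh2009, Def 3.3 p.73] -/
@[simp] theorem actionOf_actFn {P : Type} [Group P] (ρ : P →* Twist A) (p : P) :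
    (actionOf A ρ).actFn p = actFnHom (ρ p) := rfl

/-! ## §3 Content: the character on the constants, the Kummer twist on `U_m`, recorded torsion, non-degeneracy -/

variable {A}

omit [Finite A] in
/-- **Roots of unity move through the CHARACTER**: `((a, u), g) · ζ = u(ζ)`. [cite: MochizukiEtTh2009, Def 3.3 p.73] -/
theorem actFnHom_zeta (x : Twist A) (ζ : A) : actFnHom x (zeta A ζ) = zeta A (x.1.right ζ) := by
  refine Prod.ext ?_ ?_
  · change x.1.right ζ * x.1.left ^ (Multiplicative.toAdd (1 : Multiplicative (ℤ × ℤ))).2 = x.1.right ζ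
    rw [toAdd_one, Prod.snd_zero, zpow_zero, mul_one]
  · change shearFn (Multiplicative.toAdd x.2) 1 = 1
    exact map_one _

omit [Finite A] in
/-- **`ϖ_m` is fixed** by the whole twist group. [cite: MochizukiEtTh2009, Def 3.3 p.73] -/
theorem actFnHom_unif (x : Twist A) : actFnHom x (unif A) = unif A := by
  refine Prod.ext ?_ (Multiplicative.toAdd.injective ?_)
  · change x.1.right 1 * x.1.left ^ (Multiplicative.toAdd (Multiplicative.ofAdd ((1 : ℤ), (0 : ℤ)))).2 = 1
    rw [map_one, toAdd_ofAdd, zpow_zero, mul_one]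
  · change Multiplicative.toAdd (shearFn (Multiplicative.toAdd x.2) (Multiplicative.ofAdd ((1 : ℤ), (0 : ℤ)))) = ((1 : ℤ), (0 : ℤ))
    rw [toAdd_shearFn, toAdd_ofAdd]
    simp

omit [Finite A] in
/-- **The Kummer twist and the translation on `U_m`**: `((a, u), g) · U_m = a · ϖ_m^{−g} · U_m`.
[cite: MochizukiEtTh2009, Def 3.3 p.73] -/
theorem actFnHom_coordU (x : Twist A) :
    actFnHom x (coordU A) = (x.1.left, Multiplicative.ofAdd (-Multiplicative.toAdd x.2, (1 : ℤ))) := by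
  refine Prod.ext ?_ (Multiplicative.toAdd.injective ?_)
  · change x.1.right 1 * x.1.left ^ (Multiplicative.toAdd (Multiplicative.ofAdd ((0 : ℤ), (1 : ℤ)))).2 = x.1.left
    rw [map_one, toAdd_ofAdd, zpow_one, one_mul]
  · change Multiplicative.toAdd (shearFn (Multiplicative.toAdd x.2) (Multiplicative.ofAdd ((0 : ℤ), (1 : ℤ)))) =
      (-Multiplicative.toAdd x.2, (1 : ℤ))
    rw [toAdd_shearFn, toAdd_ofAdd]
    simp

/-- **NON-VACUITY OF THE CONSTANT-FIELD ACTION**: a twist-group element fixes every constant (`L^× = μ × ⟨ϖ_m⟩`) iff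
its character component `u` is trivial.  So the constant field carries a NON-TRIVIAL Galois action exactly through
the character — the content the Kummer–Tate tower of record lacks (there `u` has nothing to act on).
[cite: MochizukiEtTh2009, Def 3.3 p.73] -/
theorem forall_const_eq_self_iff (x : Twist A) :
    (∀ f ∈ (model A).const, (action A).actFn x f = f) ↔ x.1.right = 1 := by
  constructor
  · intro h
    refine MulEquiv.ext fun ζ => ?_
    have e : (actFnHom x (zeta A ζ)).1 = ζ := congrArg Prod.fst (h (zeta A ζ) (zeta_mem_const A ζ))
    rw [actFnHom_zeta] at e
    exact e
  · intro hu f hf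
    have hk := (mem_const_iff A f).1 hf
    change actFnHom x f = f
    refine Prod.ext ?_ (Multiplicative.toAdd.injective (Prod.ext ?_ ?_))
    · change x.1.right f.1 * x.1.left ^ (Multiplicative.toAdd f.2).2 = f.1
      rw [hu, MulAut.one_apply, hk, zpow_zero, mul_one]
    · change (Multiplicative.toAdd (shearFn (Multiplicative.toAdd x.2) f.2)).1 = (Multiplicative.toAdd f.2).1
      rw [toAdd_shearFn, hk, zero_mul, sub_zero]
    · change (Multiplicative.toAdd (shearFn (Multiplicative.toAdd x.2) f.2)).2 = (Multiplicative.toAdd f.2).2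
      rw [toAdd_shearFn]

/-- In particular the element `((1, u), 1)` with `u ≠ 1` MOVES some constant. [cite: MochizukiEtTh2009, Def 3.3 p.73] -/
theorem exists_const_ne_of_ne_one {u : MulAut A} (hu : u ≠ 1) :
    ∃ f ∈ (model A).const, (action A).actFn ((SemidirectProduct.inr u, 1) : Twist A) f ≠ f := by
  by_contra h
  refine hu ((forall_const_eq_self_iff ((SemidirectProduct.inr u, 1) : Twist A)).1 fun f hf => ?_)
  by_contra h'
  exact h ⟨f, hf, h'⟩

/-- **The Def. 3.3 (iii) data of the level** at the twist-group action exist (`DivisorMonoids.ofGaloisAction`).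
[cite: MochizukiEtTh2009, Def 3.3 p.73] -/
theorem nonempty_divisorMonoids : Nonempty (DivisorMonoids.{1, 0, 0} (Action (Type 0) (Twist A))) :=
  ⟨DivisorMonoids.ofGaloisAction (action A) (cuspLaws A)⟩

/-- The root `U_m` as an equivariant family on the regular `Twist A`-set (the covering `Z_∞^{(m)}` itself):
`x ↦ x · U_m`. [cite: MochizukiEtTh2009, Def 3.3 p.73] -/
def coordUFamily : (action A).bZero (Action.leftRegular (Twist A)) :=
  ⟨fun g => (action A).actFn g (coordU A), fun _ => trivial, fun g h => by
    change (action A).actFn ((Action.leftRegular (Twist A)).ρ g h) _ = _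
    rw [Action.ofMulAction_apply, smul_eq_mul, map_mul, MulAut.mul_apply]⟩

/-- **`B₀ ≠ F₀` at the level**: the family `x ↦ x · U_m` is a log-meromorphic, NON-constant element of `B₀` of the
regular `Twist A`-set — the Def. 3.3 (iii) data are non-degenerate. [cite: MochizukiEtTh2009, Def 3.3 p.73] -/
theorem coordUFamily_not_mem_fZero : coordUFamily (A := A) ∉ (action A).fZero (Action.leftRegular (Twist A)) := by
  intro h
  have h1 := h (1 : Twist A)
  change (action A).actFn 1 (coordU A) ∈ (model A).const at h1
  rw [map_one, MulAut.one_apply] at h1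
  exact coordU_not_mem_const A h1

/-! ## §4 The «ZMod shape»: `μ_m = ℤ/m` with `(ℤ/m)ˣ` acting by multiplication — χ genuinely cyclotomic -/

/-- **The cyclotomic character mod `m` as automorphisms of `μ_m = Multiplicative (ZMod m)`**: the unit `u` acts by
`ζ^e ↦ ζ^{u e}` (multiplication by `u` on `ℤ/m`). [cite: MochizukiEtTh2009, Def 3.3 p.73] -/
def zmodChar (m : ℕ) : (ZMod m)ˣ →* MulAut (Multiplicative (ZMod m)) where
  toFun u :=
    { toFun := fun z => Multiplicative.ofAdd ((u : ZMod m) * Multiplicative.toAdd z)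
      invFun := fun z => Multiplicative.ofAdd ((↑u⁻¹ : ZMod m) * Multiplicative.toAdd z)
      left_inv := fun z => by simp [← mul_assoc]
      right_inv := fun z => by simp [← mul_assoc]
      map_mul' := fun a b => by simp [mul_add, ofAdd_add] }
  map_one' := MulEquiv.ext fun z => by simp
  map_mul' u v := MulEquiv.ext fun z => by simp [mul_assoc]

/-- `zmodChar m u (ζ^e) = ζ^{u e}`. [cite: MochizukiEtTh2009, Def 3.3 p.73] -/
@[simp] theorem zmodChar_apply (m : ℕ) (u : (ZMod m)ˣ) (e : ZMod m) :
    zmodChar m u (Multiplicative.ofAdd e) = Multiplicative.ofAdd ((u : ZMod m) * e) := rfl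

/-- `zmodChar m` is injective: distinct units act differently (`u ↦ u · 1`). [cite: MochizukiEtTh2009, Def 3.3 p.73] -/
theorem zmodChar_injective (m : ℕ) : Function.Injective (zmodChar m) := by
  intro u v h
  have e := congrArg (fun φ : MulAut (Multiplicative (ZMod m)) => Multiplicative.toAdd (φ (Multiplicative.ofAdd 1))) h
  simp only [zmodChar_apply, toAdd_ofAdd, mul_one] at e
  exact Units.ext e

/-- **A constant that MOVES under the constant-field factor** at `μ = μ_m`, `m ≥ 3`: the unit `−1 ∈ (ℤ/m)ˣ` acts
non-trivially on `μ_m ⊆ L^×` (it sends `ζ` to `ζ⁻¹ ≠ ζ`). [cite: MochizukiEtTh2009, Def 3.3 p.73] -/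
theorem exists_const_ne_of_two_lt {m : ℕ} [NeZero m] (hm : 2 < m) :
    ∃ f ∈ (model (Multiplicative (ZMod m))).const,
      (action (Multiplicative (ZMod m))).actFn ((SemidirectProduct.inr (zmodChar m (-1)), 1) :
        Twist (Multiplicative (ZMod m))) f ≠ f := by
  refine exists_const_ne_of_ne_one fun h => ?_
  have e := congrArg (fun φ : MulAut (Multiplicative (ZMod m)) => Multiplicative.toAdd (φ (Multiplicative.ofAdd 1))) h
  simp only [zmodChar_apply, toAdd_ofAdd, mul_one, MulAut.one_apply, Units.val_neg, Units.val_one] at e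
  -- `-1 = 1` in `ℤ/m` forces `m ∣ 2`
  have h2 : ((2 : ℕ) : ZMod m) = 0 := by
    have : (1 : ZMod m) + 1 = 0 := by
      calc (1 : ZMod m) + 1 = -1 + 1 := by rw [e]
        _ = 0 := neg_add_cancel 1
    simpa [one_add_one_eq_two] using this
  rw [ZMod.natCast_eq_zero_iff] at h2
  exact absurd (Nat.le_of_dvd two_pos h2) (not_le.mpr hm)

end TateTowerTwist

end LogDivisorModel

end Literature.AnabelianGeometry.EtaleTheta

end
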